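import Mathlib.NumberTheory.Chebyshev
import Literature.Analysis.Fourier.SelbergMajorantsFourier
import Literature.NumberTheory.LFunctions.SelbergArchimedeanIntegral
import Literature.NumberTheory.LFunctions.ExplicitFormulaBandLimited
import Literature.NumberTheory.LFunctions.ZetaZeroBoxEnumeration
import Literature.NumberTheory.LFunctions.MertensElementary
import Literature.NumberTheory.LFunctions.VonMangoldtWeightedSums
import HarnessLib

/-!
# Zeros of `ζ` in short intervals of the critical line under RH (Balazard–de Roton 2008, Prop. 15)

Topic `Literature/NumberTheory/LFunctions`. Everything in this file is PROVED (no definitions, no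
named facts).

M. Balazard, A. de Roton, *Notes de lecture de l'article "Partial sums of the Möbius function" de
K. Soundararajan*, arXiv:0810.3587, Prop. 15 (after A. Selberg and D. A. Goldston–S. M. Gonek,
*A note on S(t) and the zeros of the Riemann zeta-function*, Bull. LMS 39 (2007)):

> **Proposition 15 (HR).** Soit `t ≥ 4`, `Δ ≥ 2` et `0 < h ≤ √t`. On a
> `N(t+h) − N(t−h) − 2h (log t/2π)/(2π) ≤ log t/(2πΔ) − (1/π) Re Σ_{p ≤ e^{2πΔ}} (log p/p^{½+it}) F̂₊(log p/2π) + O(log Δ)`,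
> (and the analogous lower bound with `F₋`); de plus `|(log p/π) F̂±(log p/2π)| ≤ 4`.

Here `F±` are Selberg's functions of `[−h, h]` with bandwidth `Δ`
(`Literature.Analysis.Fourier.selbergMajorant/Minorant`), `F̂` the Fourier transform with kernel
`e^{−2πixξ}` (Mathlib's `𝓕`), and `Re(p^{−it} F̂₊) = F̂₊ cos(t log p)` (`F̂₊` is real). We prove
the UPPER bound in the case `0 < h ≤ 1` under the extra hypothesis `e^{πΔ} ≤ t`
(`Literature.NumberTheory.LFunctions.zetaZeroCount_short_interval_le_of_RH`, absolute constant)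
and the coefficient bound (`abs_log_mul_re_fourier_selbergMajorant_le`). In the paper's
applications (Props. 16–20) `h = πδV/log T ≤ 1` and `e^{πΔ} ≤ √T`, so nothing is lost; the
printed proof bounds the polar terms `F₊(±i/2 − t)` through property (iv) of Prop. 10 printed
with `e^{2π|Im z|}`, whereas the true size is `e^{2πΔ|Im z|}/(Δ|z|)² = e^{πΔ}/(Δt)²`, whence our
hypothesis `e^{πΔ} ≤ t`.

Proof: `N(t+h) − N(t−h) = Σ_{t−h<γ≤t+h} m(ρ) ≤ Σ_ρ m(ρ) F₊(γ − t)` (`𝟙_{[−h,h]} ≤ F₊`,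
`zetaZeroCount_sub_le_tsum`); the explicit formula for this zero sum
(`Literature.NumberTheory.LFunctions.tsum_zeros_shift_eq_explicit`); the archimedean integral
`= (2h + 1/Δ) log(t/2) + O(1)` (`SelbergArchimedeanIntegral.lean`); `F̂₊(0) = 2h + 1/Δ`, `F̂₊`
real and even, `|ξ F̂₊(ξ)| ≤ 2` (`SelbergMajorantsFourier.lean`); and the proper prime powers
`p^k`, `k ≥ 2`, contribute at most `4 · (7/2) Σ_{p ≤ e^{2πΔ}} 1/p = O(log Δ)` (Mertens,
`Literature.NumberTheory.LFunctions.sum_inv_prime_le`).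

## References

* [BalazardDeRoton2008] M. Balazard, A. de Roton, arXiv:0810.3587, Prop. 15 (and Props. 10–12).
  [cite: BalazardDeRoton2008, Prop. 15]
* D. A. Goldston, S. M. Gonek, Bull. LMS 39 (2007), 482–486, Lemma 1 and (2.3)–(2.4).
-/

noncomputable section

open Complex Filter Set MeasureTheory Topology Finset
open scoped Real FourierTransform

namespace Literature.NumberTheory.LFunctions

open Literature.Analysis.Fourier Literature.Analysis.SpecialFunctions ArithmeticFunction

namespace ShortIntervalsRH

open ChebyshevWeighted

/-! ## Elementary: Mertens on the range `p ≤ e^{2πΔ}` -/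

/-- Mertens for the range needed: `Σ_{p ≤ e^{2πΔ}} 1/p ≤ log Δ + log(2π) + 4` (`Δ ≥ 1`).
[cite: HardyWright2008, Thm 427] -/
theorem sum_inv_prime_le_log (Δ : ℝ) (hΔ : 1 ≤ Δ) :
    ∑ p ∈ (Finset.Ioc 0 ⌊Real.exp (2 * π * Δ)⌋₊).filter Nat.Prime, (1 / p : ℝ) ≤
      Real.log Δ + Real.log (2 * π) + 4 := by
  have h2 : (2 : ℝ) ≤ Real.exp (2 * π * Δ) := by
    have : (2 : ℝ) ≤ 2 * π * Δ + 1 := by nlinarith [Real.pi_gt_three]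
    exact this.trans (Real.add_one_le_exp _)
  refine (sum_inv_prime_real_le h2).trans ?_
  rw [Real.log_exp, Real.log_mul (by positivity) (by linarith), Real.log_mul (by norm_num) Real.pi_ne_zero]
  linarith

/-! ## The zero count is dominated by the zero sum of the majorant -/

/-- **`N(t+h) − N(t−h) ≤ Σ_ρ m(ρ) F₊(γ_ρ − t)`** for Selberg's majorant `F₊` of `[−h, h]`
(`𝟙_{[−h,h]}(γ − t) ≤ F₊(γ − t)`, sum over all non-trivial zeros with multiplicity).
[cite: BalazardDeRoton2008, Prop. 15 (proof)] -/
theorem zetaZeroCount_sub_le_tsum {Δ t h : ℝ} (hΔ : 0 < Δ) (hh : 0 < h)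
    (hsum : Summable fun ρ : ZetaZeros.riemannZetaNontrivialZeros ↦
      (riemannZetaZeroOrder (ρ : ℂ) : ℝ) * selbergMajorantReal Δ (-h) h ((ρ : ℂ).im - t)) :
    ((zetaZeroCount (t + h) : ℝ) - zetaZeroCount (t - h)) ≤
      ∑' ρ : ZetaZeros.riemannZetaNontrivialZeros,
        (riemannZetaZeroOrder (ρ : ℂ) : ℝ) * selbergMajorantReal Δ (-h) h ((ρ : ℂ).im - t) := by
  classical
  have hab : -h ≤ h := by linarith
  set D : Set ℂ := zetaZeroBox 0 (t + h) \ zetaZeroBox 0 (t - h) with hD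
  have hDf : D.Finite := (zetaZeroBox_finite 0 (t + h)).subset Set.sdiff_subset
  have hint : ((zetaZeroCount (t + h) : ℤ) - zetaZeroCount (t - h)) = ∑ᶠ ρ ∈ D, riemannZetaZeroOrder ρ :=
    Montgomery.zetaZeroCount_sub_eq_finsum (by linarith)
  rw [finsum_mem_eq_finite_toFinset_sum _ hDf] at hint
  have hDZ : ∀ ρ ∈ hDf.toFinset, ρ ∈ ZetaZeros.riemannZetaNontrivialZeros := fun ρ hρ ↦
    zetaZeroBox_subset_riemannZetaNontrivialZeros 0 (t + h) ((Set.Finite.mem_toFinset hDf).1 hρ).1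
  -- move to the subtype of non-trivial zeros
  set s : Finset ZetaZeros.riemannZetaNontrivialZeros :=
    hDf.toFinset.subtype (· ∈ ZetaZeros.riemannZetaNontrivialZeros) with hs
  have hsumZ : ∑ ρ ∈ hDf.toFinset, (riemannZetaZeroOrder ρ : ℝ) =
      ∑ x ∈ s, (riemannZetaZeroOrder (x : ℂ) : ℝ) := by
    rw [hs, Finset.sum_subtype_of_mem (fun ρ : ℂ ↦ (riemannZetaZeroOrder ρ : ℝ)) hDZ]
  have hcast : ((zetaZeroCount (t + h) : ℝ) - zetaZeroCount (t - h)) =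
      ∑ ρ ∈ hDf.toFinset, (riemannZetaZeroOrder ρ : ℝ) := by
    have := congrArg (fun z : ℤ ↦ (z : ℝ)) hint
    push_cast at this
    exact this
  rw [hcast, hsumZ]
  -- on `D`: `t − h < γ ≤ t + h`, so `F₊(γ − t) ≥ 1`
  have hmem : ∀ x ∈ s, t - h < (x : ℂ).im ∧ (x : ℂ).im ≤ t + h := by
    intro x hx
    rw [hs, Finset.mem_subtype] at hx
    have hxD : (x : ℂ) ∈ D := (Set.Finite.mem_toFinset hDf).1 hx
    rcases hxD with ⟨h1, h2⟩
    refine ⟨?_, h1.2.2.2.2⟩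
    by_contra hle
    rw [not_lt] at hle
    exact h2 ⟨h1.1, h1.2.1, h1.2.2.1, h1.2.2.2.1, hle⟩
  have hm0 : ∀ x : ZetaZeros.riemannZetaNontrivialZeros, (0 : ℝ) ≤ riemannZetaZeroOrder (x : ℂ) := fun x ↦ by
    exact_mod_cast riemannZetaZeroOrder_nonneg (ZetaZeros.riemannZetaNontrivialZeros.ne_one x.2)
  calc ∑ x ∈ s, (riemannZetaZeroOrder (x : ℂ) : ℝ)
      ≤ ∑ x ∈ s, (riemannZetaZeroOrder (x : ℂ) : ℝ) * selbergMajorantReal Δ (-h) h ((x : ℂ).im - t) := by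
        refine Finset.sum_le_sum fun x hx ↦ ?_
        have hind : (Icc (-h) h).indicator (fun _ ↦ (1 : ℝ)) ((x : ℂ).im - t) = 1 := by
          rw [Set.indicator_of_mem]
          obtain ⟨h1, h2⟩ := hmem x hx
          exact ⟨by linarith, by linarith⟩
        have h1 : 1 ≤ selbergMajorantReal Δ (-h) h ((x : ℂ).im - t) := by
          have := indicator_le_selbergMajorantReal hΔ hab ((x : ℂ).im - t)
          rwa [hind] at this
        calc (riemannZetaZeroOrder (x : ℂ) : ℝ) = (riemannZetaZeroOrder (x : ℂ) : ℝ) * 1 := (mul_one _).symm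
          _ ≤ _ := mul_le_mul_of_nonneg_left h1 (hm0 x)
    _ ≤ ∑' x : ZetaZeros.riemannZetaNontrivialZeros,
          (riemannZetaZeroOrder (x : ℂ) : ℝ) * selbergMajorantReal Δ (-h) h ((x : ℂ).im - t) :=
        hsum.sum_le_tsum s fun x _ ↦ mul_nonneg (hm0 x) (selbergMajorantReal_nonneg hΔ hab _)

/-! ## The coefficient bound `|(log p/π) F̂±(log p/2π)| ≤ 4` -/

/-- `|(log n/π) F̂₊(log n/2π)| ≤ 4` for `n ≥ 2` (from `|ξ F̂₊(ξ)| ≤ 2`). [cite: BalazardDeRoton2008, Prop. 15] -/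
theorem abs_log_mul_re_fourier_selbergMajorant_le {Δ h : ℝ} (hΔ : 0 < Δ) (hh : 0 ≤ h) {n : ℕ} (hn : 2 ≤ n) :
    |Real.log n / π * (𝓕 (fun x : ℝ ↦ selbergMajorant Δ (-h) h x) (Real.log n / (2 * π))).re| ≤ 4 := by
  have hab : -h ≤ h := by linarith
  have hlog : 0 < Real.log n := Real.log_pos (by exact_mod_cast hn)
  have hbound := abs_mul_norm_fourier_selbergMajorant_le hΔ hab (Real.log n / (2 * π))
  rw [abs_of_pos (by positivity)] at hbound
  rw [abs_mul, abs_of_pos (by positivity)]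
  calc Real.log n / π * |(𝓕 (fun x : ℝ ↦ selbergMajorant Δ (-h) h x) (Real.log n / (2 * π))).re|
      ≤ Real.log n / π * ‖𝓕 (fun x : ℝ ↦ selbergMajorant Δ (-h) h x) (Real.log n / (2 * π))‖ := by
        gcongr; exact Complex.abs_re_le_norm _
    _ = 2 * (Real.log n / (2 * π) * ‖𝓕 (fun x : ℝ ↦ selbergMajorant Δ (-h) h x) (Real.log n / (2 * π))‖) := by
        ring
    _ ≤ 2 * 2 := by gcongr
    _ = 4 := by norm_num

/-- `|(log n/π) F̂₋(log n/2π)| ≤ 4` for `n ≥ 2`. [cite: BalazardDeRoton2008, Prop. 15] -/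
theorem abs_log_mul_re_fourier_selbergMinorant_le {Δ h : ℝ} (hΔ : 0 < Δ) (hh : 0 ≤ h) {n : ℕ} (hn : 2 ≤ n) :
    |Real.log n / π * (𝓕 (fun x : ℝ ↦ selbergMinorant Δ (-h) h x) (Real.log n / (2 * π))).re| ≤ 4 := by
  have hab : -h ≤ h := by linarith
  have hlog : 0 < Real.log n := Real.log_pos (by exact_mod_cast hn)
  have hbound := abs_mul_norm_fourier_selbergMinorant_le hΔ hab (Real.log n / (2 * π))
  rw [abs_of_pos (by positivity)] at hbound
  rw [abs_mul, abs_of_pos (by positivity)]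
  calc Real.log n / π * |(𝓕 (fun x : ℝ ↦ selbergMinorant Δ (-h) h x) (Real.log n / (2 * π))).re|
      ≤ Real.log n / π * ‖𝓕 (fun x : ℝ ↦ selbergMinorant Δ (-h) h x) (Real.log n / (2 * π))‖ := by
        gcongr; exact Complex.abs_re_le_norm _
    _ = 2 * (Real.log n / (2 * π) * ‖𝓕 (fun x : ℝ ↦ selbergMinorant Δ (-h) h x) (Real.log n / (2 * π))‖) := by
        ring
    _ ≤ 2 * 2 := by gcongr
    _ = 4 := by norm_num

/-! ## Pieces of the explicit formula for `F₊(· − t)` -/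

/-- The polar terms are `≤ 1`: `‖F₊(±i/2 − t)‖ ≤ 1` when `e^{πΔ} ≤ t`, `t ≥ 4`, `Δ ≥ 2`, `h ≤ 1`.
[cite: BalazardDeRoton2008, Prop. 15 (proof)] -/
theorem norm_selbergMajorant_polar_le {Δ t h : ℝ} (ht : 4 ≤ t) (hΔ : 2 ≤ Δ) (hexp : Real.exp (π * Δ) ≤ t)
    (hh0 : 0 < h) (hh1 : h ≤ 1) (s : ℝ) (hs : s = 1 ∨ s = -1) :
    ‖selbergMajorant Δ (-h) h ((s : ℂ) * (I / 2) - t)‖ ≤ 1 := by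
  have hΔ0 : 0 < Δ := by linarith
  have hmin : min (-h) h = -h := min_eq_left (by linarith)
  have h1Δ : 1 / Δ ≤ 1 / 2 := by
    rw [div_le_div_iff₀ hΔ0 (by norm_num)]; linarith
  set z : ℂ := (s : ℂ) * (I / 2) - t with hz
  have hzre : z.re = -t := by rcases hs with rfl | rfl <;> simp [hz]
  have hzim : |z.im| = 1 / 2 := by
    rcases hs with rfl | rfl <;> simp [hz]
  have hcond : z.re ≤ min (-h) h - 1 / Δ := by rw [hzre, hmin]; linarith
  have hb := norm_selbergMajorant_le_of_re_le (a := -h) (b := h) hΔ0 hcond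
  rw [hzim, hmin, hzre] at hb
  refine hb.trans ?_
  have hexp' : Real.exp (2 * π * Δ * (1 / 2)) ≤ t := by
    rw [show 2 * π * Δ * (1 / 2) = π * Δ by ring]; exact hexp
  have hth : (3 / 4 * t) ^ 2 ≤ (-h - -t) ^ 2 := by nlinarith
  have htpos : 0 < t := by linarith
  have hpos : 0 < -h - -t := by linarith
  have hΔ2 : 4 ≤ Δ ^ 2 := by nlinarith
  rw [div_le_one (by positivity)]
  calc 3 / 2 * Real.exp (2 * π * Δ * (1 / 2)) ≤ 3 / 2 * t := by gcongr
    _ ≤ 4 * (3 / 4 * t) ^ 2 := by nlinarith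
    _ ≤ Δ ^ 2 * (3 / 4 * t) ^ 2 := by gcongr
    _ ≤ Δ ^ 2 * (-h - -t) ^ 2 := by gcongr

/-- The `n`-th prime-side term of the explicit formula for `F₊(· − t)` is the real number
`Λ(n) n^{−½} (1/π) F̂₊(log n/2π) cos(t log n)` (`F̂₊` real and even).
[cite: BalazardDeRoton2008, Prop. 15 (proof)] -/
theorem primeTerm_eq_ofReal (Δ h t : ℝ) (n : ℕ) :
    ((vonMangoldt n : ℝ) : ℂ) / (Real.sqrt n : ℂ) *
      ((1 / (2 * π) : ℂ) * (Complex.exp (-(t * Real.log n) * I) *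
        𝓕 (fun x : ℝ ↦ selbergMajorant Δ (-h) h x) (Real.log n / (2 * π))
        + Complex.exp ((t * Real.log n) * I) *
          𝓕 (fun x : ℝ ↦ selbergMajorant Δ (-h) h x) (-(Real.log n / (2 * π))))) =
      (((vonMangoldt n : ℝ) / Real.sqrt n * (1 / π *
        (𝓕 (fun x : ℝ ↦ selbergMajorant Δ (-h) h x) (Real.log n / (2 * π))).re *
          Real.cos (t * Real.log n)) : ℝ) : ℂ) := by
  set ξ : ℝ := Real.log n / (2 * π) with hξ
  set c : ℝ := Real.cos (t * Real.log n) with hc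
  have heven : 𝓕 (fun x : ℝ ↦ selbergMajorant Δ (-h) h x) (-ξ) = 𝓕 (fun x : ℝ ↦ selbergMajorant Δ (-h) h x) ξ :=
    fourier_selbergMajorant_symm_neg Δ h ξ
  have hreal : 𝓕 (fun x : ℝ ↦ selbergMajorant Δ (-h) h x) ξ =
      (((𝓕 (fun x : ℝ ↦ selbergMajorant Δ (-h) h x) ξ).re : ℝ) : ℂ) := by
    apply Complex.ext
    · simp
    · simp [fourier_selbergMajorant_symm_im Δ h ξ]
  set wr : ℝ := (𝓕 (fun x : ℝ ↦ selbergMajorant Δ (-h) h x) ξ).re with hwr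
  rw [heven, hreal]
  have hcos : Complex.exp (-(t * Real.log n) * I) + Complex.exp ((t * Real.log n) * I) = 2 * (c : ℂ) := by
    rw [hc, Complex.ofReal_cos, Complex.two_cos]
    push_cast
    ring_nf
  have hπ : (π : ℂ) ≠ 0 := Complex.ofReal_ne_zero.2 Real.pi_ne_zero
  rw [show Complex.exp (-(t * Real.log n) * I) * (wr : ℂ) + Complex.exp ((t * Real.log n) * I) * (wr : ℂ) =
    (Complex.exp (-(t * Real.log n) * I) + Complex.exp ((t * Real.log n) * I)) * (wr : ℂ) by ring, hcos]
  push_cast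
  field_simp

/-! ## The main theorem -/

set_option maxHeartbeats 800000 in
/-- **Balazard–de Roton 2008, Prop. 15 (upper bound), under RH** — case `0 < h ≤ 1`, with the
harmless extra hypothesis `e^{πΔ} ≤ t` (see the module docstring): with an absolute constant `C`,
for `t ≥ 4`, `Δ ≥ 2`, `e^{πΔ} ≤ t`, `0 < h ≤ 1`,
`N(t+h) − N(t−h) − 2h log(t/2π)/(2π) ≤ log t/(2πΔ) − (1/π) Σ_{p ≤ e^{2πΔ}} (log p/√p) F̂₊(log p/2π) cos(t log p) + C log Δ`,
where `Re(p^{−it} F̂₊) = F̂₊ cos(t log p)` (`F̂₊` is real). [cite: BalazardDeRoton2008, Prop. 15] -/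
theorem zetaZeroCount_short_interval_le_of_RH (hRH : RiemannHypothesis) :
    ∃ C : ℝ, ∀ t Δ h : ℝ, 4 ≤ t → 2 ≤ Δ → Real.exp (π * Δ) ≤ t → 0 < h → h ≤ 1 →
      ((zetaZeroCount (t + h) : ℝ) - zetaZeroCount (t - h)) - 2 * h * Real.log (t / (2 * π)) / (2 * π) ≤
        Real.log t / (2 * π * Δ)
        - (1 / π) * ∑ p ∈ (Finset.Ioc 0 ⌊Real.exp (2 * π * Δ)⌋₊).filter Nat.Prime,
            Real.log p / Real.sqrt p *
              (𝓕 (fun x : ℝ ↦ selbergMajorant Δ (-h) h x) (Real.log p / (2 * π))).re * Real.cos (t * Real.log p)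
        + C * Real.log Δ := by
  obtain ⟨C_E, hCE⟩ := exists_abs_integral_selbergMajorant_reDigammaQuarter_sub_le
  set B₀ : ℝ := |C_E| / (2 * π) + 2 + 14 * (Real.log (2 * π) + 4) with hB₀
  have hB₀pos : 0 ≤ B₀ := by
    have : 0 ≤ Real.log (2 * π) := Real.log_nonneg (by nlinarith [Real.pi_gt_three])
    positivity
  have hlog2 : 0 < Real.log 2 := Real.log_pos (by norm_num)
  refine ⟨14 + B₀ / Real.log 2, fun t Δ h ht hΔ hexp hh0 hh1 ↦ ?_⟩
  have hΔ0 : 0 < Δ := by linarith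
  have hΔ1 : 1 ≤ Δ := by linarith
  have hab : -h ≤ h := by linarith
  have htpos : 0 < t := by linarith
  have hlogΔ : Real.log 2 ≤ Real.log Δ := Real.log_le_log (by norm_num) hΔ
  set F : ℂ → ℂ := selbergMajorant Δ (-h) h with hFdef
  obtain ⟨K, hK, hb⟩ := exists_norm_selbergMajorant_le hΔ0 (-h) h
  have hsupp : ∀ ξ : ℝ, Δ ≤ |ξ| → 𝓕 (fun x : ℝ ↦ F x) ξ = 0 := fun ξ hξ ↦
    fourier_selbergMajorant_eq_zero hΔ0 hab hξ
  have hFreal : ∀ u : ℝ, F ((u : ℝ) : ℂ) = (selbergMajorantReal Δ (-h) h u : ℂ) := fun u ↦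
    selbergMajorant_ofReal Δ (-h) h u
  have hAreal := integrable_selbergMajorant_shift_mul_reDigammaQuarter (t := t) hΔ1 ht hh0 hh1
  have hA : Integrable fun u : ℝ ↦ F ((u - t : ℝ) : ℂ) * (reDigammaQuarter u : ℂ) := by
    refine (Complex.ofRealCLM.integrable_comp hAreal).congr (Eventually.of_forall fun u ↦ ?_)
    simp only [Complex.ofRealCLM_apply, Complex.ofReal_mul, hFreal]
  obtain ⟨hZs, hEqn⟩ := tsum_zeros_shift_eq_explicit hRH hΔ0 (differentiable_selbergMajorant Δ (-h) h)
    hK.le hb hsupp hA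
  -- (1) the left-hand side is real and dominates the zero count
  have hterm : ∀ ρ : ZetaZeros.riemannZetaNontrivialZeros,
      (riemannZetaZeroOrder (ρ : ℂ) : ℂ) * F ((((ρ : ℂ).im - t : ℝ)) : ℂ) =
        (((riemannZetaZeroOrder (ρ : ℂ) : ℝ) * selbergMajorantReal Δ (-h) h ((ρ : ℂ).im - t) : ℝ) : ℂ) := by
    intro ρ; rw [hFreal]; push_cast; ring
  have hZs' : Summable fun ρ : ZetaZeros.riemannZetaNontrivialZeros ↦
      (riemannZetaZeroOrder (ρ : ℂ) : ℝ) * selbergMajorantReal Δ (-h) h ((ρ : ℂ).im - t) := by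
    have h1 : Summable fun ρ : ZetaZeros.riemannZetaNontrivialZeros ↦
        |(riemannZetaZeroOrder (ρ : ℂ) : ℝ) * selbergMajorantReal Δ (-h) h ((ρ : ℂ).im - t)| := by
      refine hZs.congr fun ρ ↦ ?_
      rw [hterm, Complex.norm_real, Real.norm_eq_abs]
    exact h1.of_abs
  set Zr : ℝ := ∑' ρ : ZetaZeros.riemannZetaNontrivialZeros,
    (riemannZetaZeroOrder (ρ : ℂ) : ℝ) * selbergMajorantReal Δ (-h) h ((ρ : ℂ).im - t) with hZr
  have hLHS : ∑' ρ : ZetaZeros.riemannZetaNontrivialZeros,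
      (riemannZetaZeroOrder (ρ : ℂ) : ℂ) * F ((((ρ : ℂ).im - t : ℝ)) : ℂ) = (Zr : ℂ) := by
    rw [hZr, Complex.ofReal_tsum]
    exact tsum_congr hterm
  have hcount := zetaZeroCount_sub_le_tsum (t := t) hΔ0 hh0 hZs'
  -- (2) the prime side as a real finite sum
  set N : ℕ := ⌊Real.exp (2 * π * Δ)⌋₊ with hN
  set w : ℝ → ℝ := fun ξ ↦ (𝓕 (fun x : ℝ ↦ F x) ξ).re with hw
  set term : ℕ → ℝ := fun n ↦ (vonMangoldt n : ℝ) / Real.sqrt n * (1 / π * w (Real.log n / (2 * π)) *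
    Real.cos (t * Real.log n)) with htermdef
  have hS : ∑' n : ℕ, ((vonMangoldt n : ℝ) : ℂ) / (Real.sqrt n : ℂ) *
      ((1 / (2 * π) : ℂ) * (Complex.exp (-(t * Real.log n) * I) * 𝓕 (fun x : ℝ ↦ F x) (Real.log n / (2 * π))
        + Complex.exp ((t * Real.log n) * I) * 𝓕 (fun x : ℝ ↦ F x) (-(Real.log n / (2 * π))))) =
      ((∑ n ∈ Finset.Ioc 0 N, term n : ℝ) : ℂ) := by
    rw [tsum_eq_sum (s := Finset.Ioc 0 N)]
    · rw [Complex.ofReal_sum]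
      refine Finset.sum_congr rfl fun n _ ↦ ?_
      simp only [htermdef, hw, hFdef]
      exact primeTerm_eq_ofReal Δ h t n
    · intro n hn
      rw [Finset.mem_Ioc, not_and_or, not_lt, not_le] at hn
      rcases hn with hn | hn
      · have : n = 0 := by omega
        subst this; simp
      · -- `n > e^{2πΔ}`: both Fourier values vanish
        have hn1 : Real.exp (2 * π * Δ) < n := by
          have := Nat.lt_floor_add_one (Real.exp (2 * π * Δ))
          rw [← hN] at this
          exact this.trans_le (by exact_mod_cast hn)
        have hnpos : (0 : ℝ) < n := (Real.exp_pos _).trans hn1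
        have hξ : Δ ≤ |Real.log n / (2 * π)| := by
          rw [abs_of_pos (div_pos (Real.log_pos (by
            have : (1 : ℝ) < Real.exp (2 * π * Δ) := by
              have : (0:ℝ) < 2 * π * Δ := by positivity
              exact Real.one_lt_exp_iff.2 this
            linarith)) (by positivity))]
          rw [le_div_iff₀ (by positivity), ← Real.log_exp (Δ * (2 * π))]
          refine Real.log_le_log (Real.exp_pos _) ?_
          rw [show Δ * (2 * π) = 2 * π * Δ by ring]; exact hn1.le
        have hξ' : Δ ≤ |-(Real.log n / (2 * π))| := by rwa [abs_neg]
        rw [hsupp _ hξ, hsupp _ hξ']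
        simp
  -- split the finite sum: primes / proper prime powers / the rest
  have hsplit : ∑ n ∈ Finset.Ioc 0 N, term n =
      ∑ p ∈ (Finset.Ioc 0 N).filter Nat.Prime, term p +
        ∑ n ∈ (Finset.Ioc 0 N).filter (fun n ↦ IsPrimePow n ∧ ¬ n.Prime), term n := by
    rw [← Finset.sum_filter_add_sum_filter_not (Finset.Ioc 0 N) Nat.Prime term]
    congr 1
    rw [← Finset.sum_filter_add_sum_filter_not ((Finset.Ioc 0 N).filter (fun n ↦ ¬ n.Prime)) IsPrimePow term]
    have hzero : ∑ n ∈ ((Finset.Ioc 0 N).filter (fun n ↦ ¬ n.Prime)).filter (fun n ↦ ¬ IsPrimePow n), term n = 0 := by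
      refine Finset.sum_eq_zero fun n hn ↦ ?_
      rw [Finset.mem_filter] at hn
      simp only [htermdef, ArithmeticFunction.vonMangoldt_eq_zero_iff.2 hn.2, zero_div, zero_mul]
    rw [hzero, add_zero, Finset.filter_filter]
    refine Finset.sum_congr ?_ fun _ _ ↦ rfl
    ext n; simp only [Finset.mem_filter]; tauto
  have hprimes : ∑ p ∈ (Finset.Ioc 0 N).filter Nat.Prime, term p =
      (1 / π) * ∑ p ∈ (Finset.Ioc 0 N).filter Nat.Prime,
        Real.log p / Real.sqrt p * w (Real.log p / (2 * π)) * Real.cos (t * Real.log p) := by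
    rw [Finset.mul_sum]
    refine Finset.sum_congr rfl fun p hp ↦ ?_
    rw [Finset.mem_filter] at hp
    simp only [htermdef, ArithmeticFunction.vonMangoldt_apply_prime hp.2]
    ring
  have hpp : |∑ n ∈ (Finset.Ioc 0 N).filter (fun n ↦ IsPrimePow n ∧ ¬ n.Prime), term n| ≤
      14 * (Real.log Δ + Real.log (2 * π) + 4) := by
    refine (Finset.abs_sum_le_sum_abs _ _).trans ?_
    have hle : ∀ n ∈ (Finset.Ioc 0 N).filter (fun n ↦ IsPrimePow n ∧ ¬ n.Prime), |term n| ≤ 4 * (1 / Real.sqrt n) := by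
      intro n hn
      rw [Finset.mem_filter] at hn
      have hn2 : 2 ≤ n := hn.2.1.two_le
      have hnpos : (0 : ℝ) < n := by exact_mod_cast (by omega : 0 < n)
      have h4 := abs_log_mul_re_fourier_selbergMajorant_le hΔ0 hh0.le hn2
      have hΛ : (vonMangoldt n : ℝ) ≤ Real.log n := ArithmeticFunction.vonMangoldt_le_log
      have hΛ0 : (0 : ℝ) ≤ vonMangoldt n := ArithmeticFunction.vonMangoldt_nonneg
      have hlogpos : 0 < Real.log n := Real.log_pos (by exact_mod_cast hn2)
      simp only [htermdef, hw, hFdef]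
      rw [abs_mul, abs_div, abs_of_nonneg hΛ0, abs_of_pos (Real.sqrt_pos.2 hnpos)]
      have hcos : |Real.cos (t * Real.log n)| ≤ 1 := Real.abs_cos_le_one _
      have hkey : |1 / π * (𝓕 (fun x : ℝ ↦ selbergMajorant Δ (-h) h x) (Real.log n / (2 * π))).re *
          Real.cos (t * Real.log n)| ≤ 4 / Real.log n := by
        rw [abs_mul]
        have h5 : |1 / π * (𝓕 (fun x : ℝ ↦ selbergMajorant Δ (-h) h x) (Real.log n / (2 * π))).re| ≤ 4 / Real.log n := by
          rw [le_div_iff₀ hlogpos]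
          calc |1 / π * (𝓕 (fun x : ℝ ↦ selbergMajorant Δ (-h) h x) (Real.log n / (2 * π))).re| * Real.log n
              = |Real.log n / π * (𝓕 (fun x : ℝ ↦ selbergMajorant Δ (-h) h x) (Real.log n / (2 * π))).re| := by
                rw [abs_mul, abs_mul, abs_of_pos (by positivity : (0 : ℝ) < 1 / π),
                  abs_of_pos (by positivity : (0 : ℝ) < Real.log n / π)]
                ring
            _ ≤ 4 := h4
        calc |1 / π * (𝓕 (fun x : ℝ ↦ selbergMajorant Δ (-h) h x) (Real.log n / (2 * π))).re| *
              |Real.cos (t * Real.log n)| ≤ 4 / Real.log n * 1 := by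
              gcongr
          _ = 4 / Real.log n := mul_one _
      calc (vonMangoldt n : ℝ) / Real.sqrt n *
            |1 / π * (𝓕 (fun x : ℝ ↦ selbergMajorant Δ (-h) h x) (Real.log n / (2 * π))).re * Real.cos (t * Real.log n)|
          ≤ Real.log n / Real.sqrt n * (4 / Real.log n) := by gcongr
        _ = 4 * (1 / Real.sqrt n) := by field_simp
    calc ∑ n ∈ (Finset.Ioc 0 N).filter (fun n ↦ IsPrimePow n ∧ ¬ n.Prime), |term n|
        ≤ ∑ n ∈ (Finset.Ioc 0 N).filter (fun n ↦ IsPrimePow n ∧ ¬ n.Prime), 4 * (1 / Real.sqrt n) :=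
          Finset.sum_le_sum hle
      _ = 4 * ∑ n ∈ (Finset.Ioc 0 N).filter (fun n ↦ IsPrimePow n ∧ ¬ n.Prime), (1 / Real.sqrt n : ℝ) := by
          rw [Finset.mul_sum]
      _ ≤ 4 * ((7 / 2) * ∑ p ∈ (Finset.Ioc 0 N).filter Nat.Prime, (1 / p : ℝ)) := by
          gcongr
          have hX : (2 : ℝ) ≤ Real.exp (2 * π * Δ) := by
            have : (2 : ℝ) ≤ 2 * π * Δ + 1 := by nlinarith [Real.pi_gt_three]
            exact this.trans (Real.add_one_le_exp _)
          exact sum_properPrimePow_inv_sqrt_le hX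
      _ ≤ 4 * ((7 / 2) * (Real.log Δ + Real.log (2 * π) + 4)) := by
          gcongr
          exact sum_inv_prime_le_log Δ hΔ1
      _ = 14 * (Real.log Δ + Real.log (2 * π) + 4) := by ring
  -- (3) the archimedean side is real and bounded
  have hF0 : 𝓕 (fun x : ℝ ↦ F x) 0 = ((2 * h + 1 / Δ : ℝ) : ℂ) := by
    rw [hFdef, fourier_selbergMajorant_zero hΔ0 hab]
    congr 1; ring
  have hIint : (∫ u : ℝ, F ((u - t : ℝ) : ℂ) * (reDigammaQuarter u : ℂ)) =
      ((∫ u : ℝ, selbergMajorantReal Δ (-h) h (u - t) * reDigammaQuarter u : ℝ) : ℂ) := by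
    rw [← integral_complex_ofReal]
    refine integral_congr_ae (Eventually.of_forall fun u ↦ ?_)
    simp only [hFreal, Complex.ofReal_mul]
  set Ir : ℝ := ∫ u : ℝ, selbergMajorantReal Δ (-h) h (u - t) * reDigammaQuarter u with hIr
  have hIr : Ir ≤ (2 * h + 1 / Δ) * Real.log (t / 2) + |C_E| := by
    have := hCE Δ t h hΔ1 ht hh0 hh1
    have h2 := (abs_le.1 this).2
    linarith [le_abs_self C_E]
  have hArch : ((1 / (2 * π) : ℂ) * (∫ u : ℝ, F ((u - t : ℝ) : ℂ) * (reDigammaQuarter u : ℂ))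
      - (1 / (2 * π) : ℂ) * 𝓕 (fun x : ℝ ↦ F x) 0 * (Real.log π : ℂ)) =
      ((1 / (2 * π) * (Ir - (2 * h + 1 / Δ) * Real.log π) : ℝ) : ℂ) := by
    rw [hIint, hF0]; push_cast; ring
  have hArch_le : 1 / (2 * π) * (Ir - (2 * h + 1 / Δ) * Real.log π) ≤
      2 * h * Real.log (t / (2 * π)) / (2 * π) + Real.log t / (2 * π * Δ) + |C_E| / (2 * π) := by
    have hlogsplit : Real.log (t / 2) - Real.log π = Real.log (t / (2 * π)) := by
      rw [← Real.log_div (by positivity) Real.pi_ne_zero]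
      congr 1; field_simp
    have h1 : Ir - (2 * h + 1 / Δ) * Real.log π ≤ (2 * h + 1 / Δ) * Real.log (t / (2 * π)) + |C_E| := by
      rw [← hlogsplit]; nlinarith
    have h2 : (1 / Δ) * Real.log (t / (2 * π)) ≤ (1 / Δ) * Real.log t := by
      refine mul_le_mul_of_nonneg_left (Real.log_le_log (by positivity) ?_) (by positivity)
      rw [div_le_iff₀ (by positivity)]; nlinarith [Real.pi_gt_three]
    have hπ2 : (0 : ℝ) < 1 / (2 * π) := by positivity
    calc 1 / (2 * π) * (Ir - (2 * h + 1 / Δ) * Real.log π)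
        ≤ 1 / (2 * π) * ((2 * h + 1 / Δ) * Real.log (t / (2 * π)) + |C_E|) :=
          mul_le_mul_of_nonneg_left h1 hπ2.le
      _ = 2 * h * Real.log (t / (2 * π)) / (2 * π) + 1 / (2 * π) * ((1 / Δ) * Real.log (t / (2 * π))) +
            |C_E| / (2 * π) := by ring
      _ ≤ 2 * h * Real.log (t / (2 * π)) / (2 * π) + 1 / (2 * π) * ((1 / Δ) * Real.log t) + |C_E| / (2 * π) := by
          gcongr
      _ = _ := by field_simp
  -- (4) the polar side
  have hP : (selbergMajorant Δ (-h) h (I / 2 - t)).re + (selbergMajorant Δ (-h) h (-(I / 2) - t)).re ≤ 2 := by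
    have h1 := norm_selbergMajorant_polar_le (Δ := Δ) (t := t) ht hΔ hexp hh0 hh1 1 (Or.inl rfl)
    have h2 := norm_selbergMajorant_polar_le (Δ := Δ) (t := t) ht hΔ hexp hh0 hh1 (-1) (Or.inr rfl)
    simp only [Complex.ofReal_one, one_mul, Complex.ofReal_neg, neg_one_mul] at h1 h2
    have h3 := (Complex.re_le_norm (selbergMajorant Δ (-h) h (I / 2 - t))).trans h1
    have h4 := (Complex.re_le_norm (selbergMajorant Δ (-h) h (-(I / 2) - t))).trans h2
    linarith
  -- (5) assemble
  rw [hLHS, hS, hArch] at hEqn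
  have hre := congrArg Complex.re hEqn
  simp only [Complex.ofReal_re, Complex.sub_re, Complex.add_re] at hre
  -- `Zr = P.re − Σ term + arch`
  rw [hsplit, hprimes] at hre
  have hpp' := (abs_le.1 hpp).1
  have hfinal : Zr ≤ 2 - (1 / π) * ∑ p ∈ (Finset.Ioc 0 N).filter Nat.Prime,
        Real.log p / Real.sqrt p * w (Real.log p / (2 * π)) * Real.cos (t * Real.log p)
      + 14 * (Real.log Δ + Real.log (2 * π) + 4)
      + (2 * h * Real.log (t / (2 * π)) / (2 * π) + Real.log t / (2 * π * Δ) + |C_E| / (2 * π)) := by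
    linarith
  have hCbound : 2 + 14 * (Real.log (2 * π) + 4) + |C_E| / (2 * π) ≤ (B₀ / Real.log 2) * Real.log Δ := by
    rw [div_mul_eq_mul_div, le_div_iff₀ hlog2]
    have : 2 + 14 * (Real.log (2 * π) + 4) + |C_E| / (2 * π) = B₀ := by rw [hB₀]; ring
    rw [this]
    nlinarith
  calc ((zetaZeroCount (t + h) : ℝ) - zetaZeroCount (t - h)) - 2 * h * Real.log (t / (2 * π)) / (2 * π)
      ≤ Zr - 2 * h * Real.log (t / (2 * π)) / (2 * π) := by linarith
    _ ≤ Real.log t / (2 * π * Δ)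
        - (1 / π) * ∑ p ∈ (Finset.Ioc 0 N).filter Nat.Prime,
            Real.log p / Real.sqrt p * w (Real.log p / (2 * π)) * Real.cos (t * Real.log p)
        + (14 + B₀ / Real.log 2) * Real.log Δ := by nlinarith

end ShortIntervalsRH

end Literature.NumberTheory.LFunctions
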